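import Summits.QuantumFields.YangMills.Theorems.LuscherReductionRunningReductionOneSiteTailGlue
import Summits.QuantumFields.YangMills.Theorems.LuscherReductionRunningReductionOneSiteTailWindow
import Summits.QuantumFields.YangMills.Theorems.LuscherReductionRunningReductionLevelGapSummable
import HarnessLib

/-!
# Item stmt-QuantumFields-20204 `OneSiteTail`: the DOORS, composed — what closes the item, by name

Third glue module (seat ym-luscher-20007-p2 g4).  `x_k(B) = levelValue su2Rep 1 B k / levelValue su2Rep 1 B 0`, `λ_b = bareLambda`,
`E_{k+1} = physLevel (k+1)` (Lüscher's invariant min–max levels), `Δ_k = levelGap k`.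

* `windowFloor_of_levelWindow`: a WINDOW FLOOR IN LEVEL CURRENCY — for every window constant `c₁ > 0` there are `C₀`, `B0` with
  `E + C₀ < E_{k+1} ⟹ λ_k(B) ≤ e^{−λ_b E} λ_0(B)` for all `k`, all `E ∈ [0, c₁ log B]`, all `B ≥ B0` (a `k`-UNIFORM version of the upper half
  of the proved crux ONE with an additive loss `C₀` instead of `C_kλ_b²`, asked only up to femto energy `c₁ log B`; the form announced by seat
  ym-luscher-20007-p1 g4) — gives the windowed Laplace-summable floor of `traceBound_of_hs_of_windowFloor` with profile
  `g(k) = max 0 (E_{k+1} − C₀ − 1)`, Laplace-summable by the tree's `LGS.levelGapSummable_all`.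
* `windowFloor_of_levelWindow'`: the same for ANY window function `ω` that eventually dominates every `c₁ log B` (e.g. `c_w B^{1/12}`).
* compositions to THE ROUTE DECL `Theses.LuscherReduction.OneSiteTail` by name: `oneSiteTail_route_of_hs_of_windowFloor`,
  `oneSiteTail_route_of_hs_of_levelWindow`, `oneSiteTail_route_of_hs_of_levelWindow'`.

So item 20204 is CLOSED by: (S1) a polynomial Hilbert–Schmidt ratio bound `Σ_{j<n} x_j(B)² ≤ C·B^q` and (S2) a window floor in level
currency (log window, or any faster window).  HONEST FRAMING: elementary; S1 and S2 are NOT proved here; femto rung R2b1 (one-site lattice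
quantum mechanics); not infinite volume, not a mass gap, not Clay.  References: Lüscher 1983 §1; Simon 1983 (Ann. Phys. 146) Cor. 4.
-/

set_option autoImplicit false

noncomputable section

open Filter Topology
open Literature.MathematicalPhysics.QuantumFieldTheory
open Literature.MathematicalPhysics.QuantumLattice
open Literature.Analysis.OperatorTheory.YMMatrixModel

namespace Summit.QuantumFields.YangMills.Theorems.FemtoTransferGap.OSTail

/-- The profile `g(k) = max 0 (E_{k+1} − a)` is Laplace-summable for every shift `a` (from `LGS.levelGapSummable_all`). -/
theorem summable_exp_neg_mul_physLevel_shift (a t : ℝ) (ht : 0 < t) :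
    Summable fun k : ℕ => Real.exp (-t * max 0 (physLevel (k + 1) - a)) := by
  have hS := LGS.levelGapSummable_all t ht
  refine Summable.of_nonneg_of_le (fun k => (Real.exp_pos _).le) (fun k => ?_)
    (hS.mul_left (Real.exp (t * (a - physLevel 1))))
  rw [← Real.exp_add]
  refine Real.exp_le_exp.2 ?_
  have h1 : physLevel (k + 1) - a ≤ max 0 (physLevel (k + 1) - a) := le_max_right _ _
  have h2 : -t * max 0 (physLevel (k + 1) - a) ≤ -t * (physLevel (k + 1) - a) := by nlinarith
  unfold levelGap
  linarith

/-- **Level-currency window floor at ONE window constant `c₁` (window function `ω ≥ c₁ log B` eventually) ⟹ the `c₁`-instance of the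
windowed Laplace-summable floor**, with profile `g(k) = max 0 (E_{k+1} − C₀ − 1)`. -/
theorem windowFloor_of_levelWindow_at (c₁ : ℝ) (hc₁ : 0 < c₁) (ω : ℝ → ℝ)
    (hω : ∃ B1 : ℝ, ∀ B : ℝ, B1 ≤ B → c₁ * Real.log B ≤ ω B)
    (hL : ∃ C₀ B0 : ℝ, ∀ B : ℝ, B0 ≤ B → ∀ E : ℝ, 0 ≤ E → E ≤ ω B →
      ∀ k : ℕ, E + C₀ < physLevel (k + 1) →
        levelValue su2Rep 1 B k ≤ Real.exp (-(bareLambda B * E)) * levelValue su2Rep 1 B 0) :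
    ∃ g : ℕ → ℝ, (∀ k, 0 ≤ g k) ∧
      (∀ t : ℝ, 0 < t → Summable fun k : ℕ => Real.exp (-t * g k)) ∧
      ∃ B0 : ℝ, ∀ B : ℝ, B0 ≤ B → ∀ k : ℕ,
        levelValue su2Rep 1 B k ≤ Real.exp (-(bareLambda B * min (g k) (c₁ * Real.log B))) * levelValue su2Rep 1 B 0 := by
  obtain ⟨C₀, B0, h⟩ := hL
  obtain ⟨B1, hB1⟩ := hω
  refine ⟨fun k => max 0 (physLevel (k + 1) - (C₀ + 1)), fun k => le_max_left _ _,
    fun t ht => summable_exp_neg_mul_physLevel_shift (C₀ + 1) t ht, max (max B0 B1) 1, fun B hB k => ?_⟩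
  have hB0 : B0 ≤ B := le_trans ((le_max_left _ _).trans (le_max_left _ _)) hB
  have hB1' : B1 ≤ B := le_trans ((le_max_right _ _).trans (le_max_left _ _)) hB
  have hBone : 1 ≤ B := le_trans (le_max_right _ _) hB
  have hlog : 0 ≤ Real.log B := Real.log_nonneg hBone
  have hm0 : 0 ≤ min (max 0 (physLevel (k + 1) - (C₀ + 1))) (c₁ * Real.log B) :=
    le_min (le_max_left _ _) (by positivity)
  rcases eq_or_lt_of_le hm0 with hm | hm
  · rw [← hm, mul_zero, neg_zero, Real.exp_zero, one_mul]
    exact levelValue_le_of_le (L := 1) (by linarith) (Nat.zero_le k)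
  · have hmle : min (max 0 (physLevel (k + 1) - (C₀ + 1))) (c₁ * Real.log B) ≤ ω B :=
      (min_le_right _ _).trans (hB1 B hB1')
    have hmax : max 0 (physLevel (k + 1) - (C₀ + 1)) = physLevel (k + 1) - (C₀ + 1) := by
      refine max_eq_right ?_
      by_contra hneg
      rw [not_le] at hneg
      have h0 : max 0 (physLevel (k + 1) - (C₀ + 1)) = 0 := max_eq_left hneg.le
      have : min (max 0 (physLevel (k + 1) - (C₀ + 1))) (c₁ * Real.log B) ≤ 0 := by
        rw [h0]; exact min_le_left _ _
      linarith
    have hmE : min (max 0 (physLevel (k + 1) - (C₀ + 1))) (c₁ * Real.log B) + C₀ < physLevel (k + 1) := by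
      have h1 : min (max 0 (physLevel (k + 1) - (C₀ + 1))) (c₁ * Real.log B) ≤ physLevel (k + 1) - (C₀ + 1) := by
        exact (min_le_left _ _).trans hmax.le
      linarith
    exact h B hB0 _ hm.le hmle k hmE

/-- ★ **Level-currency window floor (log window, every `c₁`) ⟹ windowed Laplace-summable floor** (the hypothesis `hW` of
`traceBound_of_hs_of_windowFloor`). -/
theorem windowFloor_of_levelWindow
    (hL : ∀ c₁ : ℝ, 0 < c₁ → ∃ C₀ B0 : ℝ, ∀ B : ℝ, B0 ≤ B → ∀ E : ℝ, 0 ≤ E → E ≤ c₁ * Real.log B →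
      ∀ k : ℕ, E + C₀ < physLevel (k + 1) →
        levelValue su2Rep 1 B k ≤ Real.exp (-(bareLambda B * E)) * levelValue su2Rep 1 B 0) :
    ∀ c₁ : ℝ, 0 < c₁ → ∃ g : ℕ → ℝ, (∀ k, 0 ≤ g k) ∧
      (∀ t : ℝ, 0 < t → Summable fun k : ℕ => Real.exp (-t * g k)) ∧
      ∃ B0 : ℝ, ∀ B : ℝ, B0 ≤ B → ∀ k : ℕ,
        levelValue su2Rep 1 B k ≤ Real.exp (-(bareLambda B * min (g k) (c₁ * Real.log B))) * levelValue su2Rep 1 B 0 :=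
  fun c₁ hc₁ => windowFloor_of_levelWindow_at c₁ hc₁ (fun B => c₁ * Real.log B) ⟨0, fun _ _ => le_rfl⟩ (hL c₁ hc₁)

/-- ★ **Level-currency window floor for ONE window function `ω` dominating every `c₁ log B` eventually** (e.g. `ω B = c_w B^{1/12}`)
**⟹ windowed Laplace-summable floor.** -/
theorem windowFloor_of_levelWindow' (ω : ℝ → ℝ)
    (hω : ∀ c₁ : ℝ, 0 < c₁ → ∃ B1 : ℝ, ∀ B : ℝ, B1 ≤ B → c₁ * Real.log B ≤ ω B)
    (hL : ∃ C₀ B0 : ℝ, ∀ B : ℝ, B0 ≤ B → ∀ E : ℝ, 0 ≤ E → E ≤ ω B →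
      ∀ k : ℕ, E + C₀ < physLevel (k + 1) →
        levelValue su2Rep 1 B k ≤ Real.exp (-(bareLambda B * E)) * levelValue su2Rep 1 B 0) :
    ∀ c₁ : ℝ, 0 < c₁ → ∃ g : ℕ → ℝ, (∀ k, 0 ≤ g k) ∧
      (∀ t : ℝ, 0 < t → Summable fun k : ℕ => Real.exp (-t * g k)) ∧
      ∃ B0 : ℝ, ∀ B : ℝ, B0 ≤ B → ∀ k : ℕ,
        levelValue su2Rep 1 B k ≤ Real.exp (-(bareLambda B * min (g k) (c₁ * Real.log B))) * levelValue su2Rep 1 B 0 :=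
  fun c₁ hc₁ => windowFloor_of_levelWindow_at c₁ hc₁ ω (hω c₁ hc₁) hL

/-- Power windows dominate log windows: for `a, c > 0`, every `c₁ log B ≤ c·B^a` eventually in `B`. -/
theorem log_window_le_pow_window {a c : ℝ} (ha : 0 < a) (hc : 0 < c) :
    ∀ c₁ : ℝ, 0 < c₁ → ∃ B1 : ℝ, ∀ B : ℝ, B1 ≤ B → c₁ * Real.log B ≤ c * B ^ a := by
  intro c₁ hc₁
  -- log B = (2/a) log (B^{a/2}) ≤ (2/a) B^{a/2}, and (2c₁/a) B^{a/2} ≤ c B^a once B^{a/2} ≥ 2c₁/(a c)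
  refine ⟨max 1 ((2 * c₁ / (a * c)) ^ (2 / a)), fun B hB => ?_⟩
  have hB1 : 1 ≤ B := le_trans (le_max_left _ _) hB
  have hBpos : 0 < B := by linarith
  have hBr : (2 * c₁ / (a * c)) ^ (2 / a) ≤ B := le_trans (le_max_right _ _) hB
  have hy : 0 < B ^ (a / 2) := Real.rpow_pos_of_pos hBpos _
  have hlog : Real.log B = (2 / a) * Real.log (B ^ (a / 2)) := by
    rw [Real.log_rpow hBpos]; field_simp
  have hlogle : Real.log (B ^ (a / 2)) ≤ B ^ (a / 2) :=
    (Real.log_le_sub_one_of_pos hy).trans (by linarith)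
  have hthr : 2 * c₁ / (a * c) ≤ B ^ (a / 2) := by
    have h0 : 0 ≤ 2 * c₁ / (a * c) := by positivity
    have h1 : ((2 * c₁ / (a * c)) ^ (2 / a)) ^ (a / 2) ≤ B ^ (a / 2) :=
      Real.rpow_le_rpow (by positivity) hBr (by positivity)
    rwa [← Real.rpow_mul h0, show (2 / a) * (a / 2) = 1 by field_simp, Real.rpow_one] at h1
  have hsq : B ^ a = B ^ (a / 2) * B ^ (a / 2) := by
    rw [← Real.rpow_add hBpos]; ring_nf
  calc c₁ * Real.log B = (2 * c₁ / a) * Real.log (B ^ (a / 2)) := by rw [hlog]; ring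
    _ ≤ (2 * c₁ / a) * B ^ (a / 2) := mul_le_mul_of_nonneg_left hlogle (by positivity)
    _ = (2 * c₁ / (a * c)) * (c * B ^ (a / 2)) := by field_simp
    _ ≤ B ^ (a / 2) * (c * B ^ (a / 2)) := mul_le_mul_of_nonneg_right hthr (by positivity)
    _ = c * B ^ a := by rw [hsq]; ring

/-- ★ **HS ratio bound ∧ windowed Laplace-summable floor ⟹ THE ROUTE DECL `Theses.LuscherReduction.OneSiteTail`** (item 20204) by name. -/
theorem oneSiteTail_route_of_hs_of_windowFloor
    (hHS : ∃ C : ℝ, ∃ q : ℕ, ∃ B0 : ℝ, ∀ B : ℝ, B0 ≤ B → ∀ n : ℕ,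
      ∑ j ∈ Finset.range n, (levelValue su2Rep 1 B j / levelValue su2Rep 1 B 0) ^ 2 ≤ C * B ^ q)
    (hW : ∀ c₁ : ℝ, 0 < c₁ → ∃ g : ℕ → ℝ, (∀ k, 0 ≤ g k) ∧
      (∀ t : ℝ, 0 < t → Summable fun k : ℕ => Real.exp (-t * g k)) ∧
      ∃ B0 : ℝ, ∀ B : ℝ, B0 ≤ B → ∀ k : ℕ,
        levelValue su2Rep 1 B k ≤ Real.exp (-(bareLambda B * min (g k) (c₁ * Real.log B))) * levelValue su2Rep 1 B 0) :
    Summit.QuantumFields.YangMills.Theses.LuscherReduction.OneSiteTail :=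
  oneSiteTail_route_of_traceBound (traceBound_of_hs_of_windowFloor hHS hW)

/-- ★★ **HS ratio bound ∧ level-currency window floor (log window) ⟹ `Theses.LuscherReduction.OneSiteTail`** by name. -/
theorem oneSiteTail_route_of_hs_of_levelWindow
    (hHS : ∃ C : ℝ, ∃ q : ℕ, ∃ B0 : ℝ, ∀ B : ℝ, B0 ≤ B → ∀ n : ℕ,
      ∑ j ∈ Finset.range n, (levelValue su2Rep 1 B j / levelValue su2Rep 1 B 0) ^ 2 ≤ C * B ^ q)
    (hL : ∀ c₁ : ℝ, 0 < c₁ → ∃ C₀ B0 : ℝ, ∀ B : ℝ, B0 ≤ B → ∀ E : ℝ, 0 ≤ E → E ≤ c₁ * Real.log B →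
      ∀ k : ℕ, E + C₀ < physLevel (k + 1) →
        levelValue su2Rep 1 B k ≤ Real.exp (-(bareLambda B * E)) * levelValue su2Rep 1 B 0) :
    Summit.QuantumFields.YangMills.Theses.LuscherReduction.OneSiteTail :=
  oneSiteTail_route_of_hs_of_windowFloor hHS (windowFloor_of_levelWindow hL)

/-- ★★ **HS ratio bound ∧ level-currency window floor with a POWER window `c_w·B^a` (`a, c_w > 0`; seat ym-luscher-20007-p1 g4 announces
`a = 1/12`) ⟹ `Theses.LuscherReduction.OneSiteTail`** by name. -/
theorem oneSiteTail_route_of_hs_of_powWindow {a c_w : ℝ} (ha : 0 < a) (hc : 0 < c_w)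
    (hHS : ∃ C : ℝ, ∃ q : ℕ, ∃ B0 : ℝ, ∀ B : ℝ, B0 ≤ B → ∀ n : ℕ,
      ∑ j ∈ Finset.range n, (levelValue su2Rep 1 B j / levelValue su2Rep 1 B 0) ^ 2 ≤ C * B ^ q)
    (hL : ∃ C₀ B0 : ℝ, ∀ B : ℝ, B0 ≤ B → ∀ E : ℝ, 0 ≤ E → E ≤ c_w * B ^ a →
      ∀ k : ℕ, E + C₀ < physLevel (k + 1) →
        levelValue su2Rep 1 B k ≤ Real.exp (-(bareLambda B * E)) * levelValue su2Rep 1 B 0) :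
    Summit.QuantumFields.YangMills.Theses.LuscherReduction.OneSiteTail :=
  oneSiteTail_route_of_hs_of_windowFloor hHS
    (windowFloor_of_levelWindow' (fun B => c_w * B ^ a) (log_window_le_pow_window ha hc) hL)

/-! ### Appendix (same seat): AFFINE level windows — slope `A > 0` in front of the femto energy

The per-function inequalities of ONE's INNER lane read backwards give energy bounds with crude slopes (e.g. `𝔮(u) ≤ (4a/t + C)∫G²` in
`…OneSiteTailFlat.lean`, seat ym-luscher-20007-p1 g4), i.e. a window floor of the shape `A·E + C₀ < E_{k+1} ⟹ λ_k ≤ e^{−λ_b E} λ_0`.  Any slope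
`A > 0` is as good as slope `1` for the tail bound: the profile becomes `g(k) = max 0 ((E_{k+1} − C₀ − 1)/A)`, still Laplace-summable. -/

/-- The profile `max 0 ((E_{k+1} − a)/A)` is Laplace-summable for every shift `a` and slope `A > 0`. -/
theorem summable_exp_neg_mul_physLevel_affine (a A t : ℝ) (hA : 0 < A) (ht : 0 < t) :
    Summable fun k : ℕ => Real.exp (-t * max 0 ((physLevel (k + 1) - a) / A)) := by
  have h := summable_exp_neg_mul_physLevel_shift a (t / A) (div_pos ht hA)
  refine h.congr fun k => ?_
  congr 1
  rcases le_total 0 (physLevel (k + 1) - a) with hk | hk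
  · rw [max_eq_right hk, max_eq_right (div_nonneg hk hA.le)]
    field_simp
  · rw [max_eq_left hk, max_eq_left (div_nonpos_of_nonpos_of_nonneg hk hA.le)]
    ring

/-- **Affine level-currency window floor at ONE window constant `c₁` ⟹ the `c₁`-instance of the windowed Laplace-summable floor.**
Hypothesis: for `B ≥ B0`, `E ∈ [0, ω B]`, all `k`: `A·E + C₀ < E_{k+1} ⟹ λ_k(B) ≤ e^{−λ_b E} λ_0(B)` (`A > 0`); `ω ≥ c₁ log B` eventually. -/
theorem windowFloor_of_affineLevelWindow_at (c₁ : ℝ) (hc₁ : 0 < c₁) (ω : ℝ → ℝ)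
    (hω : ∃ B1 : ℝ, ∀ B : ℝ, B1 ≤ B → c₁ * Real.log B ≤ ω B)
    {A : ℝ} (hA : 0 < A)
    (hL : ∃ C₀ B0 : ℝ, ∀ B : ℝ, B0 ≤ B → ∀ E : ℝ, 0 ≤ E → E ≤ ω B →
      ∀ k : ℕ, A * E + C₀ < physLevel (k + 1) →
        levelValue su2Rep 1 B k ≤ Real.exp (-(bareLambda B * E)) * levelValue su2Rep 1 B 0) :
    ∃ g : ℕ → ℝ, (∀ k, 0 ≤ g k) ∧
      (∀ t : ℝ, 0 < t → Summable fun k : ℕ => Real.exp (-t * g k)) ∧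
      ∃ B0 : ℝ, ∀ B : ℝ, B0 ≤ B → ∀ k : ℕ,
        levelValue su2Rep 1 B k ≤ Real.exp (-(bareLambda B * min (g k) (c₁ * Real.log B))) * levelValue su2Rep 1 B 0 := by
  obtain ⟨C₀, B0, h⟩ := hL
  obtain ⟨B1, hB1⟩ := hω
  refine ⟨fun k => max 0 ((physLevel (k + 1) - (C₀ + 1)) / A), fun k => le_max_left _ _,
    fun t ht => summable_exp_neg_mul_physLevel_affine (C₀ + 1) A t hA ht, max (max B0 B1) 1, fun B hB k => ?_⟩
  have hB0 : B0 ≤ B := le_trans ((le_max_left _ _).trans (le_max_left _ _)) hB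
  have hB1' : B1 ≤ B := le_trans ((le_max_right _ _).trans (le_max_left _ _)) hB
  have hBone : 1 ≤ B := le_trans (le_max_right _ _) hB
  have hlog : 0 ≤ Real.log B := Real.log_nonneg hBone
  have hm0 : 0 ≤ min (max 0 ((physLevel (k + 1) - (C₀ + 1)) / A)) (c₁ * Real.log B) :=
    le_min (le_max_left _ _) (by positivity)
  rcases eq_or_lt_of_le hm0 with hm | hm
  · rw [← hm, mul_zero, neg_zero, Real.exp_zero, one_mul]
    exact levelValue_le_of_le (L := 1) (by linarith) (Nat.zero_le k)
  · have hmle : min (max 0 ((physLevel (k + 1) - (C₀ + 1)) / A)) (c₁ * Real.log B) ≤ ω B :=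
      (min_le_right _ _).trans (hB1 B hB1')
    have hmax : max 0 ((physLevel (k + 1) - (C₀ + 1)) / A) = (physLevel (k + 1) - (C₀ + 1)) / A := by
      refine max_eq_right ?_
      by_contra hneg
      rw [not_le] at hneg
      have h0 : max 0 ((physLevel (k + 1) - (C₀ + 1)) / A) = 0 := max_eq_left hneg.le
      have : min (max 0 ((physLevel (k + 1) - (C₀ + 1)) / A)) (c₁ * Real.log B) ≤ 0 := by
        rw [h0]; exact min_le_left _ _
      linarith
    have hmE : A * min (max 0 ((physLevel (k + 1) - (C₀ + 1)) / A)) (c₁ * Real.log B) + C₀ < physLevel (k + 1) := by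
      have h1 : min (max 0 ((physLevel (k + 1) - (C₀ + 1)) / A)) (c₁ * Real.log B) ≤ (physLevel (k + 1) - (C₀ + 1)) / A :=
        (min_le_left _ _).trans hmax.le
      have h2 : A * min (max 0 ((physLevel (k + 1) - (C₀ + 1)) / A)) (c₁ * Real.log B) ≤ A * ((physLevel (k + 1) - (C₀ + 1)) / A) :=
        mul_le_mul_of_nonneg_left h1 hA.le
      have h3 : A * ((physLevel (k + 1) - (C₀ + 1)) / A) = physLevel (k + 1) - (C₀ + 1) := by field_simp
      linarith
    exact h B hB0 _ hm.le hmle k hmE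

/-- ★★ **HS ratio bound ∧ AFFINE level-currency window floor with a power window** (`A·E + C₀ < E_{k+1} ⟹ λ_k ≤ e^{−λ_bE}λ_0` for
`E ≤ c_w B^a`; `A, a, c_w > 0`) **⟹ `Theses.LuscherReduction.OneSiteTail`** by name. -/
theorem oneSiteTail_route_of_hs_of_affinePowWindow {A a c_w : ℝ} (hA : 0 < A) (ha : 0 < a) (hc : 0 < c_w)
    (hHS : ∃ C : ℝ, ∃ q : ℕ, ∃ B0 : ℝ, ∀ B : ℝ, B0 ≤ B → ∀ n : ℕ,
      ∑ j ∈ Finset.range n, (levelValue su2Rep 1 B j / levelValue su2Rep 1 B 0) ^ 2 ≤ C * B ^ q)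
    (hL : ∃ C₀ B0 : ℝ, ∀ B : ℝ, B0 ≤ B → ∀ E : ℝ, 0 ≤ E → E ≤ c_w * B ^ a →
      ∀ k : ℕ, A * E + C₀ < physLevel (k + 1) →
        levelValue su2Rep 1 B k ≤ Real.exp (-(bareLambda B * E)) * levelValue su2Rep 1 B 0) :
    Summit.QuantumFields.YangMills.Theses.LuscherReduction.OneSiteTail :=
  oneSiteTail_route_of_hs_of_windowFloor hHS fun c₁ hc₁ =>
    windowFloor_of_affineLevelWindow_at c₁ hc₁ (fun B => c_w * B ^ a) (log_window_le_pow_window ha hc c₁ hc₁) hA hL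

/-- ★★ **HS ratio bound ∧ AFFINE level-currency window floor with log windows** (every `c₁`) **⟹ `Theses.LuscherReduction.OneSiteTail`**. -/
theorem oneSiteTail_route_of_hs_of_affineLevelWindow {A : ℝ} (hA : 0 < A)
    (hHS : ∃ C : ℝ, ∃ q : ℕ, ∃ B0 : ℝ, ∀ B : ℝ, B0 ≤ B → ∀ n : ℕ,
      ∑ j ∈ Finset.range n, (levelValue su2Rep 1 B j / levelValue su2Rep 1 B 0) ^ 2 ≤ C * B ^ q)
    (hL : ∀ c₁ : ℝ, 0 < c₁ → ∃ C₀ B0 : ℝ, ∀ B : ℝ, B0 ≤ B → ∀ E : ℝ, 0 ≤ E → E ≤ c₁ * Real.log B →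
      ∀ k : ℕ, A * E + C₀ < physLevel (k + 1) →
        levelValue su2Rep 1 B k ≤ Real.exp (-(bareLambda B * E)) * levelValue su2Rep 1 B 0) :
    Summit.QuantumFields.YangMills.Theses.LuscherReduction.OneSiteTail :=
  oneSiteTail_route_of_hs_of_windowFloor hHS fun c₁ hc₁ =>
    windowFloor_of_affineLevelWindow_at c₁ hc₁ (fun B => c₁ * Real.log B) ⟨0, fun _ _ => le_rfl⟩ hA (hL c₁ hc₁)

end Summit.QuantumFields.YangMills.Theorems.FemtoTransferGap.OSTail

end
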